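import Mathlib.Analysis.InnerProductSpace.PiL2
import HarnessLib
import Literature.Geometry.DiscreteGeometry.KissingPatterns

/-!
# Line `birth` of crux `FreeSplittingCertificates.ShellRigidityHcp` (stmt-AtomisticToContinuum-12561): stub `stub_normFacts`

Metric facts of the stretched anticuboctahedral shell
`S(a,t) := hcpKissingPattern.image (u ↦ a • (u + (t (u₀+u₁+u₂)/3) • (1,1,1)))`, `|t| ≤ 1/100`, `0 < a`:
every stretched shell point has norm in `(0.99 a, 1.01 a)` and lies within `a/100` of the unstretched
point `a • u`.

Proof idea. Every `u ∈ hcpKissingPattern` is `(√18)⁻¹ • intVec v` with `v ∈ hcpInt`, an explicit set of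
twelve integer vectors of squared norm `18` whose coordinate sums are `0` (hexagon) or `±6` (caps); hence
`u₀² + u₁² + u₂² = 1` and `s := u₀ + u₁ + u₂` has `s² ∈ {0, 2}`.  In coordinates,
`‖u + (t s/3) • (1,1,1)‖² = 1 + (s²/3)(2t + t²) ∈ {1, 1 + (2/3)(2t + t²)} ⊂ (0.99², 1.01²)` and the
displacement has squared norm `3 (t s/3)² = t² s²/3 ≤ (1/100)²`; finally scale by `a > 0`.
Sources: folklore (elementary coordinates of the hcp kissing pattern, Hales, *Dense Sphere Packings*, §1.3).
-/

noncomputable section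

namespace Summit.AtomisticToContinuum.Crystallization.Theorems.ShellRigidityHcpBirth

open Literature.Geometry.DiscreteGeometry

/-- The squared norm of a point of `ℝ³` in coordinates. [folklore] -/
private theorem norm_sq_coord (x : EuclideanSpace ℝ (Fin 3)) :
    ‖x‖ ^ 2 = x 0 ^ 2 + x 1 ^ 2 + x 2 ^ 2 := by
  rw [EuclideanSpace.norm_sq_eq, Fin.sum_univ_three]
  simp [Real.norm_eq_abs, sq_abs]

/-- The coordinate sums of the integer model `hcpInt`: `0` on the hexagon, `±6` on the two caps
(checked by `decide`). [folklore] -/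
private theorem sum_hcpInt :
    ∀ v ∈ hcpInt, v 0 + v 1 + v 2 = 0 ∨ v 0 + v 1 + v 2 = 6 ∨ v 0 + v 1 + v 2 = -6 := by
  decide

/-- Coordinates of a point `u` of the hcp kissing pattern: `u₀² + u₁² + u₂² = 1` and
`(u₀ + u₁ + u₂)² ∈ {0, 2}`. [folklore] -/
private theorem coord_of_mem_hcpKissingPattern {u : EuclideanSpace ℝ (Fin 3)}
    (hu : u ∈ hcpKissingPattern) :
    u 0 ^ 2 + u 1 ^ 2 + u 2 ^ 2 = 1 ∧
      ((u 0 + u 1 + u 2) ^ 2 = 0 ∨ (u 0 + u 1 + u 2) ^ 2 = 2) := by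
  obtain ⟨v, hv, rfl⟩ := Finset.mem_image.1 hu
  have hn : sqNormInt v = ((18 : ℕ) : ℤ) := sqNormInt_hcpInt v hv
  simp only [sqNormInt, Nat.cast_ofNat] at hn
  have hn' : (v 0 : ℝ) ^ 2 + (v 1 : ℝ) ^ 2 + (v 2 : ℝ) ^ 2 = 18 := by exact_mod_cast hn
  have h18 : Real.sqrt ((18 : ℕ) : ℝ) ^ 2 = 18 := by
    rw [Nat.cast_ofNat, Real.sq_sqrt (by norm_num)]
  set r : ℝ := (Real.sqrt ((18 : ℕ) : ℝ))⁻¹ with hr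
  have hr2 : r ^ 2 * 18 = 1 := by
    rw [hr, inv_pow, h18]; norm_num
  simp only [PiLp.smul_apply, intVec_apply, smul_eq_mul]
  refine ⟨?_, ?_⟩
  · have : (r * v 0) ^ 2 + (r * v 1) ^ 2 + (r * v 2) ^ 2 =
        r ^ 2 * ((v 0 : ℝ) ^ 2 + (v 1 : ℝ) ^ 2 + (v 2 : ℝ) ^ 2) := by ring
    rw [this, hn']
    exact hr2
  · have key : (r * v 0 + r * v 1 + r * v 2) ^ 2 = r ^ 2 * (((v 0 + v 1 + v 2 : ℤ) : ℝ)) ^ 2 := by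
      push_cast; ring
    rw [key]
    rcases sum_hcpInt v hv with hs | hs | hs <;> rw [hs] <;> push_cast
    · left; ring
    · right; linear_combination 2 * hr2
    · right; linear_combination 2 * hr2

/-- **stub_normFacts** (metric facts of the stretched shell `S(a,t)`, `|t| ≤ 1/100`): every stretched
shell point `a • (u + (t (u₀+u₁+u₂)/3) • (1,1,1))`, `u ∈ hcpKissingPattern`, has norm in
`(0.99 a, 1.01 a)` (exactly `a` on the hexagon, `a√(1/3 + (2/3)(1+t)²)` on the caps) and lies within
`a/100` of its unstretched position `a • u` (displacement `a|t|√(2/3)` on the caps, `0` on the hexagon).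
[folklore] -/
theorem stub_normFacts :
    ∀ a t : ℝ, 0 < a → |t| ≤ 1 / 100 →
      ∀ u ∈ hcpKissingPattern,
        99 / 100 * a < ‖a • (u + (t * (u 0 + u 1 + u 2) / 3) • intVec ![1, 1, 1])‖ ∧
        ‖a • (u + (t * (u 0 + u 1 + u 2) / 3) • intVec ![1, 1, 1])‖ < 101 / 100 * a ∧
        ‖a • (u + (t * (u 0 + u 1 + u 2) / 3) • intVec ![1, 1, 1]) - a • u‖ ≤ a / 100 := by
  intro a t ha ht u hu
  obtain ⟨hn, hs⟩ := coord_of_mem_hcpKissingPattern hu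
  obtain ⟨ht1, ht2⟩ := abs_le.mp ht
  have ht_sq : t ^ 2 ≤ 1 / 10000 := by nlinarith
  set s : ℝ := u 0 + u 1 + u 2 with hs_def
  set c : ℝ := t * s / 3 with hc_def
  set w : EuclideanSpace ℝ (Fin 3) := u + c • intVec ![1, 1, 1] with hw_def
  -- the squared norm of the stretched (unscaled) point
  have hw2 : ‖w‖ ^ 2 = 1 + s ^ 2 / 3 * (2 * t + t ^ 2) := by
    rw [norm_sq_coord]
    simp only [hw_def, hc_def, hs_def, PiLp.add_apply, PiLp.smul_apply, intVec_apply, smul_eq_mul,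
      Matrix.cons_val_zero, Matrix.cons_val_one, Matrix.cons_val_two, Matrix.head_cons,
      Matrix.tail_cons, Int.cast_one, mul_one]
    linear_combination hn
  have hw_lo2 : (99 / 100 : ℝ) ^ 2 < ‖w‖ ^ 2 := by
    rw [hw2]
    rcases hs with h0 | h2
    · rw [h0]; norm_num
    · rw [h2]; nlinarith
  have hw_hi2 : ‖w‖ ^ 2 < (101 / 100 : ℝ) ^ 2 := by
    rw [hw2]
    rcases hs with h0 | h2
    · rw [h0]; norm_num
    · rw [h2]; nlinarith
  have hw_lo : 99 / 100 < ‖w‖ := lt_of_pow_lt_pow_left₀ 2 (norm_nonneg _) hw_lo2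
  have hw_hi : ‖w‖ < 101 / 100 := lt_of_pow_lt_pow_left₀ 2 (by norm_num) hw_hi2
  -- the displacement
  have hd2 : ‖c • intVec ![1, 1, 1]‖ ^ 2 ≤ (1 / 100 : ℝ) ^ 2 := by
    rw [norm_sq_coord]
    simp only [hc_def, PiLp.smul_apply, intVec_apply, smul_eq_mul, Matrix.cons_val_zero,
      Matrix.cons_val_one, Matrix.cons_val_two, Matrix.head_cons, Matrix.tail_cons, Int.cast_one,
      mul_one]
    rcases hs with h0 | h2
    · nlinarith
    · nlinarith
  have hd : ‖c • intVec ![1, 1, 1]‖ ≤ 1 / 100 := le_of_pow_le_pow_left₀ two_ne_zero (by norm_num) hd2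
  have hnorm : ‖a • w‖ = a * ‖w‖ := by rw [norm_smul, Real.norm_of_nonneg ha.le]
  have hdiff : a • w - a • u = a • (c • intVec ![1, 1, 1]) := by
    rw [hw_def, smul_add, add_sub_cancel_left]
  refine ⟨?_, ?_, ?_⟩
  · rw [hnorm]; nlinarith
  · rw [hnorm]; nlinarith
  · rw [hdiff, norm_smul, Real.norm_of_nonneg ha.le]
    nlinarith

end Summit.AtomisticToContinuum.Crystallization.Theorems.ShellRigidityHcpBirth

end
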